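import Literature.AlgebraicGeometry.Frobenioids.PadicFrobenioidBadLocalKit
import Literature.AlgebraicGeometry.Frobenioids.ModelFrobenioidUnitAutTwist
import HarnessLib

/-!
# Frobenioids II, Ex. 1.1 (ii), the MONOGENIC `p`-adic Frobenioid `Φ = ℕ·log(c)`: the UNIT-INVERSION TWIST — a `Div_B`-preserving
# natural automorphism of `B = B₀|_D ×_{Φ₀^gp} Φ^gp` inverting every unit, whence `Aut(C) → Aut(D)` has NON-TRIVIAL KERNEL (OURS)

Mochizuki, *The geometry of Frobenioids II*, Kyushu J. Math. **62** (2008) 401–460, §1 Example 1.1 (ii) p. 8: the `p`-adic Frobenioid of a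
monoprime subfunctor `Φ ⊆ Φ₀|_D` is the model Frobenioid of `(Φ, B := B₀|_D ×_{Φ₀^gp|_D} Φ^gp → Φ^gp)` [cite: MochizukiFrdII2008, Ex 1.1 (ii) p.8];
the MONOGENIC case `Φ := ℕ·log(c)` of a constant section `c` of non-units (`Datum.monogenic`, `PadicFrobenioidMonogenic.lean`) is the one
[IUTchI] Ex. 3.2 (iv) uses for `𝒞⊢_v` («`Φ_{𝒞⊢_v} := ℕ·log_Φ(q̲_v)|_{𝒟⊢_v}` … determines a `p_v`-adic Frobenioid … [cf. [FrdII], Example 1.1, (ii)]»,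
S. Mochizuki, *Inter-universal Teichmüller theory I*, kurims manuscript (May 2020), Ex. 3.2 (iv) p. 71) and Ex. 3.3 (i) uses with `c = p_v`
([IUTchI] Ex 3.2 (iv) p.71) [claim: Mochizuki2012, status: disputed] (D-0012 claim key; nothing of that series is asserted; no side taken on
[IUTchIII] Cor. 3.12).  Mochizuki, *The geometry of Frobenioids I* (2008), Thm. 5.2 (i) p. 100 (model Frobenioids)
[cite: MochizukiFrdI2008, Thm. 5.2(i) p.100].

WHAT THIS FILE PROVES (PROOF-ONLY: theorems about OUR `Datum.monogenic`; 0 `def` · 0 `instance` · 0 notation · no `Prop` fact; cell abc-iut,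
seat abc-iut-L5-t4 gen 8, KEY R72 «COR53II-BAD-SLOT-LAWS@STAND-IN» (1), engine for `Literature/IUT/HodgeTheaters/Cor53iiBadSlotKernelAtStandIn`).
For EVERY base `base : D ⥤ PadicFld p` of `p`-adic local fields (`hloc`) and EVERY constant section `c` of non-units (`hcs`):
* `exists_unitInversionTwist` — there is a natural automorphism `σ : B^c ≅ B^c` of the rational-function monoid
  `B^c(A) = {(x, γ) ∈ K_A^× × (ℕ·log c_A)^gp | Div₀(x) = ι^gp(γ)}` with `Div_B ∘ σ = Div_B`, namely the UNIT-INVERSION TWIST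
  `σ_A(x, γ) := (x⁻¹ · c_A^{2·deg γ}, γ)` (`deg` = the exponent of `log c_A`, read through `Submonoid.powLogEquiv`; `c_A^{deg γ}` has
  `Div₀ = ι^gp(γ)`, so `σ_A` preserves the fibre product; naturality = `IsConstantSection.units_map_eq`; an involution).  On a
  DIVISOR-FREE element (`γ = 0`, i.e. `x ∈ 𝒪_{K_A}^×`) it is `x ↦ x⁻¹`; and at EVERY object `A` the divisor-free element `1 + p ∈ 𝒪_{K_A}^×`
  (valuation `1` by the ultrametric inequality, `Valuation.map_one_add_of_lt`) is FIXED by every pull-back along `Aut_D(A)` (ring maps fix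
  `1 + p`) and MOVED by `σ_A` (`(1 + p)² ≠ 1`: `K_A ⊇ ℚ_p` has characteristic `0`).
* `not_kernelTrivial_monogenic` / `not_kernelTrivial_monogenic_datum` — hence, by abc-iut-L1-t7's
  `ModelFrobenioid.not_kernelTrivial_of_unitAut_of_fixed` BY NAME, the law «every self-equivalence of the monogenic `p`-adic Frobenioid
  `C` lying over `𝟭_D` is `≅ 𝟭_C`» (abc-iut-L5's `hker`/`RigidOverBase (ModelFrobenioid.baseFunctor …)`, unfolded) is FALSE whenever
  `D` is nonempty: the kernel of `Aut(C) → Aut(D)` contains the unit-inversion twist `Ψ_σ ≇ 𝟭`.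
* `BadLocalKit.not_kernelTrivial_cdash` — the same read at abc-iut-L1-t4's bad-place export `C_v^⊢ = BadLocalKit.Cdash E hloc hc he hq'`
  over a `K_v`-relative base ([IUTchI] Ex. 3.2 (iv)'s `𝒞⊢_v → 𝒟⊢_v`; constant section = the images of `q′`).
LABEL (abc-iut-L1-lead R249 (B)): «NEGATIVE STRUCTURAL FACT ABOUT OUR MONOGENIC STAND-IN; nothing of [FrdII] beyond the Ex. 1.1 (ii)
locator asserted».  READING: a monogenic (`⊢`-type, "split": `𝒪^× · c^ℕ`) `p`-adic Frobenioid is NOT rigid over its base — consistent with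
print, where [IUTchI] Cor. 5.3 (iii) claims only SURJECTIVITY of `Isom(¹𝔉⊢, ²𝔉⊢) → Isom(¹𝔇⊢, ²𝔇⊢)`; rigidity (`hker_genuine`,
`PadicFrobenioidSelfEquivalenceUnits.lean`) needs the FULL divisor monoid (its hypotheses (INT)/(PF) fail for `ℕ·log c`).  OUR witness at OUR
model categories; not a statement of either paper; nothing here asserts abc proved or refuted; typed ≠ proved.
-/

namespace Literature.AlgebraicGeometry.Frobenioids

namespace PadicFrd

open CategoryTheory Opposite Function ValuativeRel Literature.IUT.HodgeTheaters

universe v u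

/-! ### Arithmetic of the base field: `1 + p` is a divisor-free unit with `(1 + p)² ≠ 1` -/

namespace PadicFld

variable {p : ℕ} [Fact p.Prime]

/-- A `p`-adic local field (a finite extension of `ℚ_p` with its `p`-adic valuation) has characteristic `0`.
[cite: MochizukiFrdII2008, Ex 1.1 (i) p.7] -/
theorem charZero_of_isPadicLocal {X : PadicFld.{u} p} (h : X.IsPadicLocal) : CharZero X.K := by
  obtain ⟨⟨inst, -, -⟩⟩ := h
  letI := inst
  refine ⟨fun m n hmn => ?_⟩
  have h1 : algebraMap ℚ_[p] X.K (m : ℚ_[p]) = algebraMap ℚ_[p] X.K (n : ℚ_[p]) := by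
    rw [map_natCast, map_natCast]
    exact hmn
  exact Nat.cast_injective ((algebraMap ℚ_[p] X.K).injective h1)

omit [Fact p.Prime] in
/-- `v(1 + p) = 1`: `1 + p` is a unit of `𝒪_K` (ultrametric inequality, `v(p) < 1`). [cite: MochizukiFrdII2008, Ex 1.1 (i) p.7] -/
theorem valuation_one_add_p (X : PadicFld.{u} p) : valuation X.K (1 + ((p : ℕ) : X.K)) = 1 :=
  (valuation X.K).map_one_add_of_lt X.p_lt

omit [Fact p.Prime] in
/-- `1 + p ∈ 𝒪_K^⊳`. [cite: MochizukiFrdII2008, Ex 1.1 (i) p.7] -/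
theorem one_add_p_mem_intNonzero (X : PadicFld.{u} p) : (1 + ((p : ℕ) : X.K)) ∈ intNonzero X.K := by
  refine ⟨le_of_eq (valuation_one_add_p X), fun h0 => ?_⟩
  have h := valuation_one_add_p X
  rw [h0, map_zero] at h
  exact zero_ne_one h

/-- `(1 + p)·(1 + p) ≠ 1` in a `p`-adic local field (characteristic `0`, `p ≥ 2`). [cite: MochizukiFrdII2008, Ex 1.1 (i) p.7] -/
theorem one_add_p_mul_self_ne_one {X : PadicFld.{u} p} (h : X.IsPadicLocal) :
    (1 + ((p : ℕ) : X.K)) * (1 + ((p : ℕ) : X.K)) ≠ 1 := by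
  haveI := charZero_of_isPadicLocal h
  intro e
  have e' : ((1 + p) * (1 + p) : ℕ) = 1 := by exact_mod_cast e
  have h1 : 1 + p = 1 := Nat.eq_one_of_mul_eq_one_right e'
  have hp : 2 ≤ p := (Fact.out : p.Prime).two_le
  omega

end PadicFld

namespace Monogenic

variable {D : Type u} [Category.{v} D] {p : ℕ} [Fact p.Prime] (base : D ⥤ PadicFld.{u} p)
  {c : ∀ A : D, intNonzero (base.obj A).K}

/-- Universal property of `M^gp` on generators: `lift f (of m) = f m`. [folklore] -/
private theorem gp_lift_of {M G : Type*} [CommMonoid M] [CommGroup G] (f : M →* G) (m : M) :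
    Algebra.GrothendieckGroup.lift f (Algebra.GrothendieckGroup.of m) = f m := by
  have h := Algebra.GrothendieckGroup.lift.symm_apply_apply f
  rw [Algebra.GrothendieckGroup.lift_symm_apply] at h
  exact DFunLike.congr_fun h m

omit [Fact p.Prime] in
/-- The pull-back of `Φ^c` sends `log(c)^n` to `log(c)^n` ("a constant section"), in the types of the functor `Φ^c`.
[cite: MochizukiFrdII2008, Ex 1.1 (ii) p.8] -/
theorem Φc_map_pow (hcs : IsConstantSection base c) {A A' : Dᵒᵖ} (f : A ⟶ A') (n : ℕ) :
    ((Φc base hcs).map f).hom (Submonoid.pow (gen base c A.unop) n) = Submonoid.pow (gen base c A'.unop) n := by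
  apply Subtype.ext
  change phi0Map base f (gen base c A.unop ^ n) = gen base c A'.unop ^ n
  rw [map_pow, phi0Map_gen base hcs]

/-- **THE UNIT-INVERSION TWIST of the monogenic datum.**  For a base of `p`-adic local fields and a constant section `c` of non-units there
is a natural automorphism `σ : B^c ≅ B^c` of the rational-function monoid of `Datum.monogenic` (`σ_A(x, γ) = (x⁻¹ · c_A^{2 deg γ}, γ)`) such that:
(1) `Div_B ∘ σ = Div_B`; (2) on every divisor-free element `σ` INVERTS the `K^×`-component (`(σ u)|_{K^×} · u|_{K^×} = 1`); (3) at every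
object `A` the element `(1 + p, 0) ∈ B^c(A)` is divisor-free, fixed by the pull-back along every `e ∈ Aut_D(A)`, and moved by `σ_A`.  OURS;
not a construction of the paper. [cite: MochizukiFrdII2008, Ex 1.1 (ii) p.8] -/
theorem exists_unitInversionTwist (hcs : IsConstantSection base c) (hloc : ∀ A : D, (base.obj A).IsPadicLocal) :
    ∃ σ : Bc base hcs ≅ Bc base hcs,
      (∀ (A : D) (u : (Bc base hcs).obj (op A)),
          divB (Φc base hcs) (Bc base hcs) (divBc base hcs) (op A) ((σ.hom.app (op A)).hom u) =
            divB (Φc base hcs) (Bc base hcs) (divBc base hcs) (op A) u) ∧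
      (∀ (A : D) (u : (Bc base hcs).obj (op A)),
          divB (Φc base hcs) (Bc base hcs) (divBc base hcs) (op A) u = 1 →
            ((toB0c base hcs).app (op A)).hom ((σ.hom.app (op A)).hom u) * ((toB0c base hcs).app (op A)).hom u = 1) ∧
      (∀ A : D, ∃ u : (Bc base hcs).obj (op A),
          divB (Φc base hcs) (Bc base hcs) (divBc base hcs) (op A) u = 1 ∧
          (∀ e : A ≅ A, pull (Bc base hcs) e.hom u = u) ∧ (σ.hom.app (op A)).hom u ≠ u) := by
  classical
  -- `Φ^c(A) = ℕ·log(c_A)` is free on its generator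
  have hinj : ∀ A : Dᵒᵖ, Injective fun n : ℕ => gen base c A.unop ^ n := fun A => gen_pow_injective base hcs (hloc A.unop)
  -- typed views: the constant section in `K_A^×`, and the `K^×`-component of an element of `B^c(A)` (the carrier of `B₀|_D(A)` is
  -- `K_A^×` up to unfolding only)
  let cU : ∀ A : Dᵒᵖ, ((base.obj A.unop).K)ˣ := fun A => intNonzeroToUnits (base.obj A.unop).K (c A.unop)
  let xU : ∀ A : Dᵒᵖ, (Bc base hcs).obj A → ((base.obj A.unop).K)ˣ := fun A u => u.1.1
  -- the section `γ ↦ c_A^{deg γ}` of `Div₀` over `ι^gp`, on the monoid `Φ^c(A)` and on its groupification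
  let t : ∀ A : Dᵒᵖ, (Φc base hcs).obj A →* ((base.obj A.unop).K)ˣ := fun A =>
    (powersHom ((base.obj A.unop).K)ˣ (cU A)).comp (Submonoid.powLogEquiv (hinj A)).symm.toMonoidHom
  let s : ∀ A : Dᵒᵖ, Algebra.GrothendieckGroup ((Φc base hcs).obj A) →* ((base.obj A.unop).K)ˣ := fun A =>
    Algebra.GrothendieckGroup.lift (t A)
  have ht : ∀ (A : Dᵒᵖ) (n : ℕ), t A (Submonoid.pow (gen base c A.unop) n) = cU A ^ n := by
    intro A n
    change powersHom _ _ ((Submonoid.powLogEquiv (hinj A)).symm (Submonoid.pow (gen base c A.unop) n)) = _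
    rw [Submonoid.powLogEquiv_symm_apply, Submonoid.log_pow_eq_self (hinj A), powersHom_apply, toAdd_ofAdd]
  have hs : ∀ (A : Dᵒᵖ) (n : ℕ), s A (Algebra.GrothendieckGroup.of (Submonoid.pow (gen base c A.unop) n)) = cU A ^ n := by
    intro A n
    change Algebra.GrothendieckGroup.lift (t A) _ = _
    rw [gp_lift_of, ht]
  -- (P) `Div₀ (s γ) = ι^gp γ`
  have hP : ∀ (A : Dᵒᵖ) (γ : Algebra.GrothendieckGroup ((Φc base hcs).obj A)),
      divZeroHom (base.obj A.unop).K (s A γ) = MonGp.map ((ιc base hcs).app A).hom γ := by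
    intro A
    have key : (divZeroHom (base.obj A.unop).K).comp (s A) = MonGp.map ((ιc base hcs).app A).hom :=
      MonGp.hom_ext fun z => by
        obtain ⟨n, rfl⟩ : ∃ n, Submonoid.pow (gen base c A.unop) n = z := ⟨Submonoid.log z, Submonoid.pow_log_eq_self z⟩
        rw [MonoidHom.comp_apply, hs, map_pow]
        change divZeroHom _ (intNonzeroToUnits (base.obj A.unop).K (c A.unop)) ^ n = _
        rw [divZeroHom_intNonzeroToUnits, ← map_pow]
        exact (MonGp.map_of ((ιc base hcs).app A).hom (Submonoid.pow (gen base c A.unop) n)).symm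
    exact fun γ => DFunLike.congr_fun key γ
  -- (N) naturality of `s`: `s_{A'} ∘ (Φ^c)^gp(f) = B₀(f) ∘ s_A`
  have hN : ∀ {A A' : Dᵒᵖ} (f : A ⟶ A') (γ : Algebra.GrothendieckGroup ((Φc base hcs).obj A)),
      s A' (MonGp.map ((Φc base hcs).map f).hom γ) =
        Units.map ((base.map f.unop).alg : (base.obj A.unop).K →* (base.obj A'.unop).K) (s A γ) := by
    intro A A' f
    have key : (s A').comp (MonGp.map ((Φc base hcs).map f).hom) =
        (Units.map ((base.map f.unop).alg : (base.obj A.unop).K →* (base.obj A'.unop).K)).comp (s A) :=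
      MonGp.hom_ext fun z => by
        obtain ⟨n, rfl⟩ : ∃ n, Submonoid.pow (gen base c A.unop) n = z := ⟨Submonoid.log z, Submonoid.pow_log_eq_self z⟩
        rw [MonoidHom.comp_apply, MonoidHom.comp_apply, MonGp.map_of, Φc_map_pow base hcs, hs, hs, map_pow]
        exact congrArg (· ^ n) (IsConstantSection.units_map_eq base hcs f.unop).symm
    exact fun γ => DFunLike.congr_fun key γ
  -- membership of an element of `B^c(A)`, unfolded
  have hmem : ∀ (A : Dᵒᵖ) (u : (Bc base hcs).obj A),
      divZeroHom (base.obj A.unop).K (xU A u) = MonGp.map ((ιc base hcs).app A).hom u.1.2 := fun A u => u.2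
  -- the twist on elements: `(x, γ) ↦ (x⁻¹ · (s γ)², γ)`
  have hσmem : ∀ (A : Dᵒᵖ) (u : (Bc base hcs).obj A),
      (((xU A u)⁻¹ * s A u.1.2 ^ 2, u.1.2) : (bZeroOn base).obj A × Algebra.GrothendieckGroup ((Φc base hcs).obj A)) ∈
        BSub base hcs A := by
    intro A u
    rw [mem_BSub_iff]
    change divZeroHom (base.obj A.unop).K ((xU A u)⁻¹ * s A u.1.2 ^ 2) = MonGp.map ((ιc base hcs).app A).hom u.1.2
    rw [map_mul, map_inv, map_pow, hP, hmem, pow_two, inv_mul_cancel_left]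
  let σf : ∀ A : Dᵒᵖ, (Bc base hcs).obj A → (Bc base hcs).obj A := fun A u => ⟨(_, u.1.2), hσmem A u⟩
  have hσf_fst : ∀ (A : Dᵒᵖ) (u : (Bc base hcs).obj A), xU A (σf A u) = (xU A u)⁻¹ * s A u.1.2 ^ 2 := fun _ _ => rfl
  have hσf_snd : ∀ (A : Dᵒᵖ) (u : (Bc base hcs).obj A), (σf A u).1.2 = u.1.2 := fun _ _ => rfl
  have hext : ∀ (A : Dᵒᵖ) (u w : (Bc base hcs).obj A), xU A u = xU A w → u.1.2 = w.1.2 → u = w :=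
    fun A u w h1 h2 => Subtype.ext (Prod.ext h1 h2)
  have hσf_inv : ∀ (A : Dᵒᵖ) (u : (Bc base hcs).obj A), σf A (σf A u) = u := by
    intro A u
    refine hext A _ _ ?_ rfl
    rw [hσf_fst, hσf_fst, hσf_snd, mul_inv_rev, inv_inv, inv_mul_cancel_comm]
  have hσf_mul : ∀ (A : Dᵒᵖ) (u w : (Bc base hcs).obj A), σf A (u * w) = σf A u * σf A w := by
    intro A u w
    refine hext A _ _ ?_ rfl
    change (xU A (u * w))⁻¹ * s A (u * w).1.2 ^ 2 = ((xU A u)⁻¹ * s A u.1.2 ^ 2) * ((xU A w)⁻¹ * s A w.1.2 ^ 2)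
    rw [show xU A (u * w) = xU A u * xU A w from rfl, show (u * w).1.2 = u.1.2 * w.1.2 from rfl, map_mul, mul_pow, mul_inv,
      mul_mul_mul_comm]
    rfl
  -- as multiplicative equivalences and as a natural automorphism of `B^c`
  let σe : ∀ A : Dᵒᵖ, (Bc base hcs).obj A ≃* (Bc base hcs).obj A := fun A =>
    { toFun := σf A
      invFun := σf A
      left_inv := hσf_inv A
      right_inv := hσf_inv A
      map_mul' := hσf_mul A }
  let σ : Bc base hcs ≅ Bc base hcs :=
    NatIso.ofComponents (fun A => (σe A).toCommMonCatIso) (fun {A A'} f => by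
      apply CommMonCat.hom_ext
      apply MonoidHom.ext
      intro u
      change σf A' (((Bc base hcs).map f).hom u) = ((Bc base hcs).map f).hom (σf A u)
      refine hext A' _ _ ?_ rfl
      change (Units.map ((base.map f.unop).alg : (base.obj A.unop).K →* (base.obj A'.unop).K) (xU A u))⁻¹ *
          s A' (MonGp.map ((Φc base hcs).map f).hom u.1.2) ^ 2 =
        Units.map ((base.map f.unop).alg : (base.obj A.unop).K →* (base.obj A'.unop).K) ((xU A u)⁻¹ * s A u.1.2 ^ 2)
      rw [hN, map_mul, map_inv, map_pow])
  have hσapp : ∀ (A : Dᵒᵖ) (u : (Bc base hcs).obj A), (σ.hom.app A).hom u = σf A u := fun _ _ => rfl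
  refine ⟨σ, fun A u => ?_, fun A u hu => ?_, fun A => ?_⟩
  · -- (1) `Div_B ∘ σ = Div_B`
    rw [hσapp]
    rfl
  · -- (2) inversion of the `K^×`-component on divisor-free elements
    rw [hσapp]
    change xU (op A) (σf (op A) u) * xU (op A) u = 1
    have hu' : u.1.2 = 1 := hu
    rw [hσf_fst, hu', map_one, one_pow, mul_one, inv_mul_cancel]
  · -- (3) the divisor-free element `1 + p`, fixed by `Aut_D(A)`, moved by `σ_A`
    let cu : ((base.obj A).K)ˣ :=
      intNonzeroToUnits (base.obj A).K ⟨1 + ((p : ℕ) : (base.obj A).K), PadicFld.one_add_p_mem_intNonzero (base.obj A)⟩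
    have hcu : divZeroHom (base.obj A).K cu = 1 := by
      change divZeroHom (base.obj A).K (intNonzeroToUnits (base.obj A).K _) = 1
      rw [divZeroHom_intNonzeroToUnits, Associates.mk_eq_one.mpr
        ((isUnit_intNonzero_iff _ _).mpr (PadicFld.valuation_one_add_p (base.obj A)))]
      exact (congrArg Algebra.GrothendieckGroup.of (map_one _)).trans (map_one _)
    have hmem₀ : ((cu, 1) : (bZeroOn base).obj (op A) × Algebra.GrothendieckGroup ((Φc base hcs).obj (op A))) ∈
        BSub base hcs (op A) := by
      rw [mem_BSub_iff]
      change divZeroHom (base.obj A).K cu = MonGp.map ((ιc base hcs).app (op A)).hom 1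
      rw [hcu]
      exact (map_one _).symm
    refine ⟨⟨(cu, 1), hmem₀⟩, rfl, fun e => ?_, fun h => ?_⟩
    · -- fixed by every `e ∈ Aut_D(A)`: ring maps fix `1 + p`
      refine hext (op A) _ _ ?_ ?_
      · change Units.map ((base.map e.hom).alg : (base.obj A).K →* (base.obj A).K) cu = cu
        refine Units.ext ?_
        rw [Units.coe_map]
        change (base.map e.hom).alg (1 + ((p : ℕ) : (base.obj A).K)) = 1 + ((p : ℕ) : (base.obj A).K)
        rw [map_add, map_one, map_natCast]
      · change MonGp.map ((Φc base hcs).map e.hom.op).hom 1 = 1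
        rw [map_one]
    · -- moved: `σ_A (1 + p, 0) = ((1 + p)⁻¹, 0) ≠ (1 + p, 0)` since `(1 + p)² ≠ 1`
      rw [hσapp] at h
      have h1 : xU (op A) (σf (op A) ⟨(cu, 1), hmem₀⟩) = cu := by rw [h]
      rw [hσf_fst] at h1
      change cu⁻¹ * s (op A) 1 ^ 2 = cu at h1
      rw [map_one, one_pow, mul_one, inv_eq_iff_mul_eq_one] at h1
      exact PadicFld.one_add_p_mul_self_ne_one (hloc A) (by simpa [cu] using congrArg (fun w : ((base.obj A).K)ˣ => (w : (base.obj A).K)) h1)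

/-- **`Aut(C) → Aut(D)` has NON-TRIVIAL KERNEL at every monogenic `p`-adic Frobenioid over a nonempty base of `p`-adic local fields**
(NEGATIVE STRUCTURAL FACT ABOUT OUR MONOGENIC STAND-IN; nothing of [FrdII] beyond the Ex. 1.1 (ii) locator asserted): the law
«every self-equivalence of `C = ModelFrobenioid Φ^c B^c Div` lying over `𝟭_D` is `≅ 𝟭_C`» (abc-iut-L5's `hker` =
`RigidOverBase (ModelFrobenioid.baseFunctor …)`, unfolded) FAILS — the unit-inversion twist `Ψ_σ` lies over `𝟭_D` and is `≇ 𝟭` (abc-iut-L1-t7's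
`ModelFrobenioid.not_kernelTrivial_of_unitAut_of_fixed` at the divisor-free, `Aut_D`-fixed, `σ`-moved element `1 + p`).  OUR witness at OUR model
category; consistent with print's [IUTchI] Cor. 5.3 (iii) (surjectivity only for `⊢`-strips). [cite: MochizukiFrdII2008, Ex 1.1 (ii) p.8]
[cite: MochizukiFrdI2008, Thm. 5.2(i) p.100] -/
theorem not_kernelTrivial_monogenic (hcs : IsConstantSection base c) (hloc : ∀ A : D, (base.obj A).IsPadicLocal) [Nonempty D] :
    ¬ ∀ Ψ : ModelFrobenioid (Φc base hcs) (Bc base hcs) (divBc base hcs) ≌ ModelFrobenioid (Φc base hcs) (Bc base hcs) (divBc base hcs),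
        Nonempty (CatIsomorphism.LiesUnder (ModelFrobenioid.baseFunctor (Φc base hcs) (Bc base hcs) (divBc base hcs))
          (ModelFrobenioid.baseFunctor (Φc base hcs) (Bc base hcs) (divBc base hcs)) Ψ (CategoryTheory.Equivalence.refl (C := D))) →
        Nonempty (Ψ.functor ≅ 𝟭 (ModelFrobenioid (Φc base hcs) (Bc base hcs) (divBc base hcs))) := by
  obtain ⟨A⟩ := (inferInstance : Nonempty D)
  obtain ⟨σ, hσ, -, hfix⟩ := exists_unitInversionTwist base hcs hloc
  obtain ⟨u, hu, hfx, hne⟩ := hfix A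
  exact ModelFrobenioid.not_kernelTrivial_of_unitAut_of_fixed σ hσ hu hfx hne

/-- The same for the bundled datum `Datum.monogenic base hcs hloc hc he` (its `frobenioid` and base functor; `D` is nonempty as it is
connected): **¬ `hker` at the monogenic `p`-adic Frobenioid** — in particular at abc-iut-L1-t4's `BadLocalKit.Cdash` = [IUTchI] Ex. 3.2 (iv)'s
`𝒞⊢_v` over `𝒟⊢_v` (`hcs := RelEmb.isConstantSection`). [cite: MochizukiFrdII2008, Ex 1.1 (ii) p.8] [cite: MochizukiFrdI2008, Thm. 5.2(i) p.100] -/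
theorem not_kernelTrivial_monogenic_datum (hcs : IsConstantSection base c) (hloc : ∀ A : D, (base.obj A).IsPadicLocal)
    (hc : IsConnected D) (he : IsTotallyEpimorphic D) :
    ¬ ∀ Ψ : (Datum.monogenic base hcs hloc hc he).frobenioid ≌ (Datum.monogenic base hcs hloc hc he).frobenioid,
        Nonempty (CatIsomorphism.LiesUnder
          (ModelFrobenioid.baseFunctor _ _ (Datum.monogenic base hcs hloc hc he).divB)
          (ModelFrobenioid.baseFunctor _ _ (Datum.monogenic base hcs hloc hc he).divB) Ψ (CategoryTheory.Equivalence.refl (C := D))) →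
        Nonempty (Ψ.functor ≅ 𝟭 (Datum.monogenic base hcs hloc hc he).frobenioid) :=
  haveI : Nonempty D := hc.is_nonempty
  not_kernelTrivial_monogenic base hcs hloc

end Monogenic

namespace BadLocalKit

variable {D : Type u} [Category.{v} D] {p : ℕ} [Fact p.Prime] {base : D ⥤ PadicFld.{u} p} {Kv : Type u} [Field Kv]
  [ValuativeRel Kv] (E : RelEmb base Kv) (hloc : ∀ A : D, (base.obj A).IsPadicLocal) (hc : IsConnected D)
  (he : IsTotallyEpimorphic D) {q' : intNonzero Kv} (hq' : ¬ IsUnit q')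

/-- **¬ `hker` at the bad-place export `C_v^⊢ → D_v^⊢`** (abc-iut-L1-t4's `BadLocalKit.Cdash`/`CdashBase`, the monogenic `p_v`-adic
Frobenioid of `ℕ·log(q′)` over a `K_v`-relative base — [IUTchI] Ex. 3.2 (iv)'s `𝒞⊢_v` with base `𝒟⊢_v`): NOT every self-equivalence of
`C_v^⊢` lying over `𝟭_{D_v^⊢}` is `≅ 𝟭` (the unit-inversion twist is not).  NEGATIVE STRUCTURAL FACT ABOUT OUR MONOGENIC STAND-IN; nothing
of [FrdII] beyond the Ex. 1.1 (ii) locator asserted. [cite: MochizukiFrdII2008, Ex 1.1 (ii) p.8] [cite: MochizukiFrdI2008, Thm. 5.2(i) p.100] -/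
theorem not_kernelTrivial_cdash :
    ¬ ∀ Ψ : Cdash E hloc hc he hq' ≌ Cdash E hloc hc he hq',
        Nonempty (CatIsomorphism.LiesUnder (CdashBase E hloc hc he hq') (CdashBase E hloc hc he hq') Ψ
          (CategoryTheory.Equivalence.refl (C := D))) →
        Nonempty (Ψ.functor ≅ 𝟭 (Cdash E hloc hc he hq')) :=
  Monogenic.not_kernelTrivial_monogenic_datum base (E.isConstantSection hq') hloc hc he

end BadLocalKit

end PadicFrd

end Literature.AlgebraicGeometry.Frobenioids
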